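import Summits.MatrixMultiplication.OmegaCensus.STPPVosperSlackTwoSoundCList
import Summits.MatrixMultiplication.OmegaCensus.STPPVosperSlackTwoLawABQ

/-!
# ω-census (abelian STPP census): the slack-2 partition law for a one-other-block leaf — REDUCTION of case C to normal form and the assembled law

HONEST FRAMING (pub-omega census; verbatim): lottery ticket; floor = certified bounds/negative ranges.
Census STRUCTURE (seat pub-omega-stpp-2 gen 27, 2026-08-28), family (b2).  `no_isSTPP_of_slack_two_rowsQ`: the three kernel row families of the
slack-2 partition law (case A / B′ up to dihedral symmetry — `slack_two_caseC_of_rowsQ`, `STPPVosperSlackTwoLawABQ.lean`; case C over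
`qShapesC b × pShapesC p a` — checker `caseCDeadQP`, soundness `caseCDeadQP'_false_of_normal_form_lists`, stpp-1's `STPPVosperSlackTwoSoundCList.lean`) exclude every
two-block STPP family of `ℤ/p` with the given sizes at slack 2 (`a, b, z, L ≥ 3`, `a + L, b + z ≥ 7`; Hamidoune–Rødseth as the named fact
`HamidouneRodsethInverseTheorem`, a tree theorem — `hamidouneRodsethInverseTheorem_holds`).  The reduction (`exists_eq_image_erase_of_subset_apFinset`
+ dilation by the inverse of the `(Bᵢ, Z°)`-difference + the `N + 2 = 4` translations) follows stpp-1's `caseADeadQ'_false_of_isAP`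
(`STPPVosperSlackTwoSoundAReduce.lean`).  UNCONDITIONAL given `hHR`; no `decide`.  Nothing here is progress on `ω`.

References: H. Cohn, R. Kleinberg, B. Szegedy, C. Umans, FOCS 2005 (arXiv:math/0511460), Def. 5.1; A. G. Vosper, J. London Math. Soc. 31 (1956);
Y. O. Hamidoune, Ø. J. Rødseth, Acta Arith. 92 (2000).
-/

open Finset
open scoped Pointwise

namespace Summit.MatrixMultiplication.OmegaCensus.CubeNB.S2

open Literature.Computability.AlgebraicComplexity
open Literature.Combinatorics.Additive
open Summit.MatrixMultiplication.OmegaCensus.STPPKneser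
open Summit.MatrixMultiplication.OmegaCensus.CubeNB.Bits

variable {p : ℕ} [hp : Fact p.Prime]

/-- **An `n`-subset of an `(n+1)`-term progression is the progression minus one term**, written with the hole index in `[1, n]`
(if the missing term is the first one, re-base at the second term and call the hole `n`). [cite: HamidouneRodseth2000, main theorem (§1, p. 252)] -/
theorem exists_eq_image_erase_of_subset_apFinset {X : Finset (ZMod p)} {s d : ZMod p} {n : ℕ} (hd : d ≠ 0) (hn : n + 1 ≤ p) (h1n : 1 ≤ n)
    (hX : X ⊆ apFinset s d (n + 1)) (hcard : #X = n) :
    ∃ (s' : ZMod p) (h : ℕ), 1 ≤ h ∧ h ≤ n ∧ X = ((range (n + 1)).erase h).image fun k : ℕ => s' + (k : ZMod p) * d := by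
  have hAP : #(apFinset s d (n + 1)) = n + 1 := card_apFinset hd hn
  have hdiff : #(apFinset s d (n + 1) \ X) = 1 := by rw [card_sdiff, inter_eq_left.2 hX, hAP, hcard]; omega
  obtain ⟨w, hw⟩ := card_eq_one.1 hdiff
  have hwmem : w ∈ apFinset s d (n + 1) \ X := by rw [hw]; exact mem_singleton_self w
  rw [mem_sdiff] at hwmem
  obtain ⟨h₁, hh₁, hwe⟩ := mem_apFinset.1 hwmem.1
  -- injectivity of the index on `[0, n]`
  have hinj : ∀ i j : ℕ, i < n + 1 → j < n + 1 → s + i • d = s + j • d → i = j := by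
    intro i j hi hj hij
    rw [add_right_inj, nsmul_eq_mul, nsmul_eq_mul] at hij
    have := mul_right_cancel₀ hd hij
    have := congrArg ZMod.val this
    rwa [ZMod.val_natCast_of_lt (by omega), ZMod.val_natCast_of_lt (by omega)] at this
  have hXmem : ∀ x, x ∈ X ↔ ∃ i, i < n + 1 ∧ i ≠ h₁ ∧ s + i • d = x := by
    intro x
    constructor
    · intro hx
      obtain ⟨i, hi, rfl⟩ := mem_apFinset.1 (hX hx)
      refine ⟨i, hi, fun hih => ?_, rfl⟩
      rw [hih, hwe] at hx; exact hwmem.2 hx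
    · rintro ⟨i, hi, hih, rfl⟩
      by_contra hx
      have hmem : s + i • d ∈ apFinset s d (n + 1) \ X := mem_sdiff.2 ⟨mem_apFinset.2 ⟨i, hi, rfl⟩, hx⟩
      rw [hw, mem_singleton, ← hwe] at hmem
      exact hih (hinj i h₁ hi hh₁ hmem)
  by_cases hh : 1 ≤ h₁
  · refine ⟨s, h₁, hh, by omega, ?_⟩
    ext x
    rw [hXmem, mem_image]
    constructor
    · rintro ⟨i, hi, hih, rfl⟩
      exact ⟨i, mem_erase.2 ⟨hih, mem_range.2 hi⟩, by rw [nsmul_eq_mul]⟩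
    · rintro ⟨i, hi, rfl⟩
      rw [mem_erase, mem_range] at hi
      exact ⟨i, hi.2, hi.1, by rw [nsmul_eq_mul]⟩
  · have h0 : h₁ = 0 := by omega
    refine ⟨s + d, n, h1n, le_rfl, ?_⟩
    ext x
    rw [hXmem, mem_image]
    constructor
    · rintro ⟨i, hi, hih, rfl⟩
      have hi1 : 1 ≤ i := by omega
      refine ⟨i - 1, mem_erase.2 ⟨by omega, mem_range.2 (by omega)⟩, ?_⟩
      rw [nsmul_eq_mul, Nat.cast_sub hi1, Nat.cast_one]; ring
    · rintro ⟨j, hj, rfl⟩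
      rw [mem_erase, mem_range] at hj
      refine ⟨j + 1, by omega, by omega, ?_⟩
      rw [nsmul_eq_mul, Nat.cast_add, Nat.cast_one]; ring


/-- **THE SLACK-2 PARTITION LAW for a one-other-block leaf (two blocks), rows up to symmetry.**  For a two-block STPP family of `ℤ/p` at slack 2
(block `i` of sizes `(a, b, c)`, the other block `(a₀, b₀, c₀)`, `L = b₀c₀`, `z = a₀c₀`, `z + b + abc + a + L = p`, `a, b, z, L ≥ 3`, `a + L, b + z ≥ 7`),
the three row families — case A and case B′ up to the dihedral symmetry of the free shape (`slack_two_caseC_of_rowsQ`), case C over the Hamidoune–Rødseth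
shapes `qShapesC b × pShapesC p a` — are contradictory.  Case C: `slack_two_caseC_of_rowsQ` leaves both pairs one above Cauchy–Davenport with
`W ⊔ SY ⊔ T = ℤ/p`; Hamidoune–Rødseth (`slack_two_caseC_HR_A/_B`) puts `Aᵢ`, `Bᵢ`, `Z°` inside progressions one term longer
(`exists_eq_image_erase_of_subset_apFinset`); the dilation by the inverse of the `(Bᵢ, Z°)`-difference and the `N + 2 = 4` translations
(`IsSTPP.comp_of_injective`, `isSTPP_dilate`, `IsSTPP.translate_shiftBC`) bring the family to the normal form of `caseCDeadQP'_false_of_normal_form_lists`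
(`Aᵢ ↦ d′·([0,a] ∖ {h′})`, `Bᵢ ↦ [0,b] ∖ {h}`, `0 ∈ Cᵢ`, `0 ∈ B_{i₀}`, `Z° ↦ ζ₀ + ([0,z] ∖ {h₀})`), whose case-C data are re-obtained from
`slack_two_caseC_of_rowsQ` applied to the normalised family; the row `caseCDeadQP … = true` at `([0,b] ∖ {h}, d′·([0,a] ∖ {h′}))` contradicts it.
[cite: CohnKleinbergSzegedyUmans2005, Def. 5.1] [cite: HamidouneRodseth2000, main theorem (§1, p. 252)] [cite: Vosper1956, main theorem; Nathanson1996, Thm 2.7] -/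
theorem no_isSTPP_of_slack_two_rowsQ (hHR : HamidouneRodsethInverseTheorem) {A B C : Fin 2 → Finset (ZMod p)} (hS : IsSTPP A B C)
    (hA : ∀ k, (A k).Nonempty) (hB : ∀ k, (B k).Nonempty) (hC : ∀ k, (C k).Nonempty) (i i₀ : Fin 2) (hii : i₀ ≠ i)
    {a b c L z a₀ b₀ c₀ vol : ℕ} (ha : #(A i) = a) (hb : #(B i) = b) (hc : #(C i) = c) (ha₀ : #(A i₀) = a₀) (hb₀ : #(B i₀) = b₀)
    (hc₀ : #(C i₀) = c₀) (hL : b₀ * c₀ = L) (hz : a₀ * c₀ = z) (hvol : a * b * c = vol) (hslack : z + b + vol + a + L = p)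
    (h3a : 3 ≤ a) (h3b : 3 ≤ b) (h3z : 3 ≤ z) (h3L : 3 ≤ L) (h7a : 7 ≤ a + L) (h7b : 7 ≤ b + z)
    (rowsA : ∀ Q ∈ qShapes p b 0 ((p - 1).choose (b - 1)), dihedralSmaller p Q = true ∨ caseADeadQ' p a c L z a₀ b₀ c₀ Q = true)
    (rowsB : ∀ Q ∈ qShapes p a 0 ((p - 1).choose (a - 1)), dihedralSmaller p Q = true ∨ caseADeadQ' p b c z L b₀ a₀ c₀ Q = true)
    (rowsC : ∀ Q ∈ qShapesC b, ∀ P ∈ pShapesC p a, caseCDeadQP p c L z a₀ b₀ c₀ Q P = true) : False := by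
  have hp0 : 0 < p := hp.out.pos
  have hI : (univ : Finset (Fin 2)).erase i = {i₀} := by
    fin_cases i <;> fin_cases i₀ <;> first | exact absurd rfl hii | decide
  have hvol' : #(A i) * #(B i) * #(C i) = vol := by rw [ha, hb, hc, hvol]
  have hz' : ∑ k ∈ univ.erase i, #(A k) * #(C k) = z := by rw [hI, sum_singleton, ha₀, hc₀, hz]
  have hL' : ∑ k ∈ univ.erase i, #(B k) * #(C k) = L := by rw [hI, sum_singleton, hb₀, hc₀, hL]
  -- case C for the given family
  obtain ⟨hSY, hT, -⟩ := slack_two_caseC_of_rowsQ hS hA hB hC i i₀ hii ha hb hc ha₀ hb₀ hc₀ hL hz hvol hslack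
    (by omega) (by omega) (by omega) (by omega) rowsA rowsB
  -- Hamidoune–Rødseth shapes
  obtain ⟨d, sA, -, hd, hAsub, -⟩ := slack_two_caseC_HR_A hHR hS hA hB hC i ha hb hvol' hz' hL' hslack h3a h3L h7a hSY
  obtain ⟨e, sB, tZ, he, hBsub, hZsub⟩ := slack_two_caseC_HR_B hHR hS hA hB hC i ha hb hvol' hz' hL' hslack h3b h3z h7b hT
  have hZcard : #(DU A C (univ.erase i)) = z := by rw [card_DU_AC hS hB, hz']
  obtain ⟨αs, h', h'1, h'a, hAeq⟩ := exists_eq_image_erase_of_subset_apFinset hd (by omega) (by omega) hAsub ha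
  obtain ⟨βs, h, hh1, hhb, hBeq⟩ := exists_eq_image_erase_of_subset_apFinset he (by omega) (by omega) hBsub hb
  obtain ⟨ζs, h₀, -, hh₀, hZeq⟩ := exists_eq_image_erase_of_subset_apFinset he (by omega) (by omega) hZsub hZcard
  -- the normalisation: dilate by `u = e⁻¹`, translate
  set u : ZMod p := e⁻¹ with hu
  have hu0 : u ≠ 0 := inv_ne_zero he
  have hue : u * e = 1 := inv_mul_cancel₀ he
  obtain ⟨γ₀, hγ₀⟩ := hC i
  obtain ⟨bs, hbs⟩ := hB i₀
  set ι : Fin 2 → Fin 2 := fun k => if k = 0 then i else i₀ with hι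
  have hι0 : ι 0 = i := by simp [hι]
  have hι1 : ι 1 = i₀ := by simp [hι]
  have hιinj : Function.Injective ι := by
    intro k k' hk
    fin_cases k <;> fin_cases k'
    · rfl
    · exfalso; simp [hι] at hk; first | exact hii hk | exact hii hk.symm
    · exfalso; simp [hι] at hk; exact hii hk
    · rfl
  have hS1 : IsSTPP (fun k => A (ι k)) (fun k => B (ι k)) (fun k => C (ι k)) := hS.comp_of_injective ι hιinj
  have hS2 : IsSTPP (fun k => (A (ι k)).image (u * ·)) (fun k => (B (ι k)).image (u * ·)) (fun k => (C (ι k)).image (u * ·)) :=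
    isSTPP_dilate hS1 hu0
  set t0 : ZMod p := -(u * αs) with ht0def
  set β : ZMod p := -(u * βs) - t0 with hβ
  set γ : ZMod p := -(u * γ₀) - t0 with hγ
  set t : Fin 2 → ZMod p := fun k => if k = 0 then t0 else -(u * bs) - β with ht
  have ht0 : t 0 = t0 := by simp [ht]
  have ht1 : t 1 = -(u * bs) - β := by simp [ht]
  have hS3 := IsSTPP.translate_shiftBC hS2 t β γ
  set A3 : Fin 2 → Finset (ZMod p) := fun k => ((A (ι k)).image (u * ·)).image (· + t k) with hA3
  set B3 : Fin 2 → Finset (ZMod p) := fun k => (((B (ι k)).image (u * ·)).image (· + t k)).image (· + β) with hB3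
  set C3 : Fin 2 → Finset (ZMod p) := fun k => (((C (ι k)).image (u * ·)).image (· + t k)).image (· + γ) with hC3
  have hS3' : IsSTPP A3 B3 C3 := hS3
  have hmemA3 : ∀ k x, x ∈ A3 k ↔ ∃ v ∈ A (ι k), u * v + t k = x := by
    intro k x; simp only [hA3, mem_image, exists_exists_and_eq_and]
  have hmemB3 : ∀ k x, x ∈ B3 k ↔ ∃ v ∈ B (ι k), u * v + t k + β = x := by
    intro k x; simp only [hB3, mem_image, exists_exists_and_eq_and]
  have hmemC3 : ∀ k x, x ∈ C3 k ↔ ∃ v ∈ C (ι k), u * v + t k + γ = x := by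
    intro k x; simp only [hC3, mem_image, exists_exists_and_eq_and]
  have hinjA : ∀ k, Function.Injective fun v : ZMod p => u * v + t k := fun k v v' h => by
    have := mul_left_cancel₀ hu0 (add_right_cancel h); exact this
  have hinjB : ∀ k, Function.Injective fun v : ZMod p => u * v + t k + β := fun k v v' h => by
    have := mul_left_cancel₀ hu0 (add_right_cancel (add_right_cancel h)); exact this
  have hinjC : ∀ k, Function.Injective fun v : ZMod p => u * v + t k + γ := fun k v v' h => by
    have := mul_left_cancel₀ hu0 (add_right_cancel (add_right_cancel h)); exact this
  have hA3eq : ∀ k, A3 k = (A (ι k)).image fun v => u * v + t k := fun k => by ext x; rw [hmemA3, mem_image]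
  have hB3eq : ∀ k, B3 k = (B (ι k)).image fun v => u * v + t k + β := fun k => by ext x; rw [hmemB3, mem_image]
  have hC3eq : ∀ k, C3 k = (C (ι k)).image fun v => u * v + t k + γ := fun k => by ext x; rw [hmemC3, mem_image]
  have hA3ne : ∀ k, (A3 k).Nonempty := fun k => by rw [hA3eq]; exact (hA _).image _
  have hB3ne : ∀ k, (B3 k).Nonempty := fun k => by rw [hB3eq]; exact (hB _).image _
  have hC3ne : ∀ k, (C3 k).Nonempty := fun k => by rw [hC3eq]; exact (hC _).image _
  have ha3 : #(A3 0) = a := by rw [hA3eq, card_image_of_injective _ (hinjA 0), hι0, ha]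
  have hb3 : #(B3 0) = b := by rw [hB3eq, card_image_of_injective _ (hinjB 0), hι0, hb]
  have hc3 : #(C3 0) = c := by rw [hC3eq, card_image_of_injective _ (hinjC 0), hι0, hc]
  have ha3₀ : #(A3 1) = a₀ := by rw [hA3eq, card_image_of_injective _ (hinjA 1), hι1, ha₀]
  have hb3₀ : #(B3 1) = b₀ := by rw [hB3eq, card_image_of_injective _ (hinjB 1), hι1, hb₀]
  have hc3₀ : #(C3 1) = c₀ := by rw [hC3eq, card_image_of_injective _ (hinjC 1), hι1, hc₀]
  -- case C for the normalised family (rows are universal)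
  obtain ⟨-, hT3, hpart3⟩ := slack_two_caseC_of_rowsQ hS3' hA3ne hB3ne hC3ne 0 1 (by decide) ha3 hb3 hc3 ha3₀ hb3₀ hc3₀ hL hz hvol hslack
    (by omega) (by omega) (by omega) (by omega) rowsA rowsB
  -- the normal-form data
  set d' : ℕ := (u * d).val with hd'
  have hd'0 : u * d ≠ 0 := mul_ne_zero hu0 hd
  have hd'1 : 1 ≤ d' := by
    rw [hd']; by_contra hlt
    exact hd'0 ((ZMod.val_eq_zero _).1 (by omega))
  have hd'p : d' < p := (u * d).val_lt
  have hA30 : A3 0 = ((range (a + 1)).erase h').image fun k : ℕ => (u * d) * (k : ZMod p) := by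
    ext x
    rw [hmemA3, hι0, hAeq, ht0, mem_image]
    constructor
    · rintro ⟨v, hv, rfl⟩
      obtain ⟨k, hk, rfl⟩ := mem_image.1 hv
      exact ⟨k, hk, by rw [ht0def]; ring⟩
    · rintro ⟨k, hk, rfl⟩
      exact ⟨αs + (k : ZMod p) * d, mem_image.2 ⟨k, hk, rfl⟩, by rw [ht0def]; ring⟩
  have hB30 : B3 0 = ((range (b + 1)).erase h).image fun k : ℕ => (k : ZMod p) := by
    ext x
    rw [hmemB3, hι0, hBeq, ht0, mem_image]
    constructor
    · rintro ⟨v, hv, rfl⟩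
      obtain ⟨k, hk, rfl⟩ := mem_image.1 hv
      refine ⟨k, hk, ?_⟩
      rw [hβ]; linear_combination (-(k : ZMod p)) * hue
    · rintro ⟨k, hk, rfl⟩
      refine ⟨βs + (k : ZMod p) * e, mem_image.2 ⟨k, hk, rfl⟩, ?_⟩
      rw [hβ]; linear_combination (k : ZMod p) * hue
  have hC30 : (0 : ZMod p) ∈ C3 0 := (hmemC3 0 0).2 ⟨γ₀, by rw [hι0]; exact hγ₀, by rw [ht0, hγ]; ring⟩
  have hB31 : (0 : ZMod p) ∈ B3 1 := (hmemB3 1 0).2 ⟨bs, by rw [hι1]; exact hbs, by rw [ht1]; ring⟩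
  have h10 : (univ : Finset (Fin 2)).erase 0 = {1} := by decide
  have hZ3 : DU A3 C3 (univ.erase 0) = ((range (z + 1)).erase h₀).image fun tt : ℕ => (u * ζs + γ) + (tt : ZMod p) := by
    ext x
    rw [h10, DU, Finset.singleton_biUnion, mem_D, mem_image]
    constructor
    · rintro ⟨a3, ha3m, c3, hc3m, rfl⟩
      obtain ⟨x, hx, rfl⟩ := (hmemA3 1 a3).1 ha3m
      obtain ⟨cc, hcc, rfl⟩ := (hmemC3 1 c3).1 hc3m
      rw [hι1] at hx hcc
      have hin : cc - x ∈ DU A C (univ.erase i) := by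
        rw [hI]; exact mem_biUnion.2 ⟨i₀, mem_singleton_self _, mem_D.2 ⟨x, hx, cc, hcc, rfl⟩⟩
      rw [hZeq] at hin
      obtain ⟨m, hm, hme⟩ := mem_image.1 hin
      refine ⟨m, hm, ?_⟩
      have : u * (cc - x) = u * ζs + m := by
        rw [← hme, mul_add, show u * ((m : ZMod p) * e) = m * (u * e) by ring, hue, mul_one]
      linear_combination (-1 : ZMod p) * this
    · rintro ⟨m, hm, rfl⟩
      have hin : ζs + (m : ZMod p) * e ∈ DU A C (univ.erase i) := by rw [hZeq]; exact mem_image.2 ⟨m, hm, rfl⟩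
      rw [hI, DU, Finset.singleton_biUnion, mem_D] at hin
      obtain ⟨x, hx, cc, hcc, hxc⟩ := hin
      refine ⟨u * x + t 1, (hmemA3 1 _).2 ⟨x, by rw [hι1]; exact hx, rfl⟩, u * cc + t 1 + γ, (hmemC3 1 _).2 ⟨cc, by rw [hι1]; exact hcc, rfl⟩, ?_⟩
      have : u * (cc - x) = u * ζs + m := by
        rw [hxc, mul_add, show u * ((m : ZMod p) * e) = m * (u * e) by ring, hue, mul_one]
      linear_combination this
  -- the value lists: the H–R shapes of the enumeration
  set QL : List ℕ := (List.range (b + 1)).filter fun x => !(Nat.beq x h) with hQL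
  set PL : List ℕ := ((List.range (a + 1)).filter fun x => !(Nat.beq x h')).map fun k => (d' * k) % p with hPL
  have hQLq : QL ∈ qShapesC b := by
    rw [qShapesC, List.mem_map]
    exact ⟨h, List.mem_range'.2 ⟨h - 1, by omega, by omega⟩, rfl⟩
  have hPLp : PL ∈ pShapesC p a := by
    rw [pShapesC, if_neg (by omega), List.mem_flatMap]
    refine ⟨d', List.mem_range'.2 ⟨d' - 1, by omega, by omega⟩, List.mem_map.2 ⟨h', List.mem_range'.2 ⟨h' - 1, by omega, by omega⟩, rfl⟩⟩
  have hfilt : ∀ (n hh k : ℕ), k ∈ (List.range (n + 1)).filter (fun x => !(Nat.beq x hh)) ↔ k < n + 1 ∧ k ≠ hh := by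
    intro n hh k
    rw [List.mem_filter, List.mem_range]
    constructor
    · rintro ⟨hk, hne⟩
      exact ⟨hk, fun hkh => by rw [hkh, Nat.beq_refl] at hne; exact Bool.noConfusion hne⟩
    · rintro ⟨hk, hne⟩
      refine ⟨hk, ?_⟩
      cases hq : Nat.beq k hh
      · rfl
      · exact absurd (Nat.eq_of_beq_eq_true hq) hne
  have hQLmem : ∀ v, v ∈ QL ↔ ∃ x ∈ B3 0, x.val = v := by
    intro v
    rw [hQL, hfilt, hB30]
    constructor
    · rintro ⟨hv, hne⟩
      exact ⟨(v : ZMod p), mem_image.2 ⟨v, mem_erase.2 ⟨hne, mem_range.2 hv⟩, rfl⟩, ZMod.val_natCast_of_lt (by omega)⟩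
    · rintro ⟨x, hx, rfl⟩
      obtain ⟨k, hk, rfl⟩ := mem_image.1 hx
      rw [mem_erase, mem_range] at hk
      rw [ZMod.val_natCast_of_lt (by omega)]
      exact ⟨hk.2, hk.1⟩
  have hQLnd : QL.Nodup := List.nodup_range.filter _
  have hPLcast : ∀ k : ℕ, ((((d' * k) % p : ℕ)) : ZMod p) = (u * d) * (k : ZMod p) := fun k => by
    rw [cast_mod_self, Nat.cast_mul, hd', ZMod.natCast_zmod_val]
  have hPLmem : ∀ v, v ∈ PL ↔ ∃ x ∈ A3 0, x.val = v := by
    intro v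
    rw [hPL, List.mem_map, hA30]
    constructor
    · rintro ⟨k, hk, rfl⟩
      rw [hfilt] at hk
      refine ⟨(u * d) * (k : ZMod p), mem_image.2 ⟨k, mem_erase.2 ⟨hk.2, mem_range.2 hk.1⟩, rfl⟩, ?_⟩
      rw [← hPLcast, ZMod.val_natCast, Nat.mod_eq_of_lt (Nat.mod_lt _ hp0)]
    · rintro ⟨x, hx, rfl⟩
      obtain ⟨k, hk, rfl⟩ := mem_image.1 hx
      rw [mem_erase, mem_range] at hk
      refine ⟨k, (hfilt _ _ _).2 ⟨hk.2, hk.1⟩, ?_⟩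
      rw [← hPLcast, ZMod.val_natCast, Nat.mod_eq_of_lt (Nat.mod_lt _ hp0)]
  have hPLnd : PL.Nodup := by
    rw [hPL]
    refine List.Nodup.map_on (fun k hk k' hk' hkk => ?_) (List.nodup_range.filter _)
    rw [hfilt] at hk hk'
    have hc := congrArg (fun n : ℕ => (n : ZMod p)) hkk
    simp only [hPLcast] at hc
    have := mul_left_cancel₀ hd'0 hc
    have := congrArg ZMod.val this
    rwa [ZMod.val_natCast_of_lt (by omega), ZMod.val_natCast_of_lt (by omega)] at this
  -- the normal form kills the row
  have key := caseCDeadQP'_false_of_normal_form_lists hS3' hA3ne hB3ne hC3ne hb3 hc3 ha3₀ hb3₀ hc3₀ hL (by omega)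
    hC30 hB31 hT3 hpart3 hh₀ hZ3 PL QL hPLmem hPLnd hQLmem hQLnd
  have row := rowsC QL hQLq PL hPLp
  rw [← caseCDeadQP'_eq, key] at row
  exact Bool.noConfusion row

end Summit.MatrixMultiplication.OmegaCensus.CubeNB.S2
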